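import Summits.KontsevichZagierPeriods.KontsevichZagierPeriods.Theses.FurushoPentagon
import Summits.KontsevichZagierPeriods.KontsevichZagierPeriods.Theorems.HoffmanRelationInKZ.Negative.HoffmanElement
import Literature.NumberTheory.Transcendental.KZProductIdeal
import Literature.NumberTheory.Transcendental.KZUnfolding
import Literature.NumberTheory.Transcendental.KZLogCalculusProofs
import Literature.NumberTheory.Transcendental.MZVWordShuffle
import Literature.NumberTheory.Transcendental.MZVSimplexRepProofs
import Literature.NumberTheory.Transcendental.SemialgebraicMapsProofs

/-!
# `HoffmanRelationInKZ`, line `dilation-homotopy-transposition`: shuffle words = splits + insertions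

Stub `stub_shuffleWords` of the crux `HoffmanRelationInKZ` (stmt-KontsevichZagierPeriods-3930, route
FurushoPentagon).  Pure list combinatorics.  For an index `s = (s₁, …, s_k)` with positive entries and
weight `n`, write `ε(s) = 0^{s₁-1} 1 ⋯ 0^{s_k-1} 1` (`MZV.binaryWord s`).  The `n` words obtained by
inserting one extra letter `1` after the first `p` letters of `ε(s)`, `p = 1, …, n`
(`(MZV.binaryWord s).insertIdx p true`), read back as indices (`MZV.ofBinaryWord`), are — as a
multiset — exactly

* Hoffman's SPLIT indices `(s₁, …, s_{i}, s_{i+1} − j, j + 1, s_{i+2}, …)`, `0 ≤ j ≤ s_{i+1} − 2`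
  (the letter lands inside the run of `0`s of a block), together with
* the `k` INSERTION indices `(s₁, …, s_{i+1}, 1, s_{i+2}, …)` (the letter lands right after the
  closing `1` of a block).

Hence the corresponding sums of `Z`-values agree for every `Z` with values in an additive
commutative monoid (`shuffleWords_finset`, by induction on `s`: the gaps inside the first block give
the splits of the first block in reverse order — `Finset.sum_range_reflect` —, the gap after its `1`
gives the first insertion, and the later gaps are the gaps of the tail with the first entry
prepended), and in particular for `Z : List ℕ → KZ.FormalRep` (`stub_shuffleWords`, the registered
`List.range` form, converted with `list_sum_range_map_finset` of the crux's support file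
`Theorems/HoffmanRelationInKZ/Negative/HoffmanElement.lean`).

References: M. E. Hoffman, *Multiple harmonic series*, Pacific J. Math. 152 (1992), Thm 5.1 (the
derivation argument); K. Ihara, M. Kaneko, D. Zagier, Compos. Math. 142 (2006), Thm 2.
-/

noncomputable section

open Set MeasureTheory
open Literature.NumberTheory.Transcendental

namespace Summit.KontsevichZagierPeriods.FurushoPentagon.HoffmanRelationInKZ

/-! ## List bookkeeping -/

/-- Inserting past a prefix: `(l₁ ++ l₂).insertIdx (|l₁| + i) a = l₁ ++ l₂.insertIdx i a`.
[folklore] -/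
theorem shuffleWords_insertIdx_length_add {α : Type*} (l₁ l₂ : List α) (i : ℕ) (a : α) :
    (l₁ ++ l₂).insertIdx (l₁.length + i) a = l₁ ++ l₂.insertIdx i a := by
  induction l₁ with
  | nil => simp
  | cons x l₁ ih =>
    rw [List.cons_append, List.length_cons, Nat.add_right_comm, List.insertIdx_succ_cons, ih,
      List.cons_append]

/-- Inserting inside a leading run of a repeated letter: for `p ≤ m`,
`(b^m w).insertIdx p a = b^p a b^{m-p} w`. [folklore] -/
theorem shuffleWords_insertIdx_replicate_append {α : Type*} (m p : ℕ) (hp : p ≤ m) (b a : α)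
    (w : List α) :
    (List.replicate m b ++ w).insertIdx p a =
      List.replicate p b ++ a :: (List.replicate (m - p) b ++ w) := by
  obtain ⟨q, rfl⟩ := Nat.exists_eq_add_of_le hp
  have h := shuffleWords_insertIdx_length_add (List.replicate p b) (List.replicate q b ++ w) 0 a
  rw [List.length_replicate, Nat.add_zero, List.insertIdx_zero] at h
  rw [List.replicate_add, List.append_assoc, Nat.add_sub_cancel_left, h]

/-! ## Reading the gap words -/

/-- Reading a closed block: `ofBinaryWord (0^m 1 w) = (m + 1) :: ofBinaryWord w`. [folklore] -/
theorem shuffleWords_ofBinaryWord_block (m : ℕ) (w : List Bool) :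
    MZV.ofBinaryWord (List.replicate m false ++ true :: w) = (m + 1) :: MZV.ofBinaryWord w := by
  unfold MZV.ofBinaryWord
  rw [MZV.ofBinaryWordAux_replicate_false_append, Nat.zero_add, MZV.ofBinaryWordAux_true]

/-- Reading a leading letter `1`: `ofBinaryWord (1 w) = 1 :: ofBinaryWord w`. [folklore] -/
theorem shuffleWords_ofBinaryWord_true (w : List Bool) :
    MZV.ofBinaryWord (true :: w) = 1 :: MZV.ofBinaryWord w := rfl

/-- The word of `(b + 1) :: t` is `0^b 1 ε(t)`. [folklore] -/
theorem shuffleWords_binaryWord_succ_cons (b : ℕ) (t : List ℕ) :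
    MZV.binaryWord ((b + 1) :: t) = List.replicate b false ++ true :: MZV.binaryWord t := by
  rw [MZV.binaryWord, Nat.add_sub_cancel, List.append_assoc, List.singleton_append]

/-- Gap inside the first run of `0`s: inserting `1` after the first `g + 1 ≤ b` letters of
`0^b 1 ε(t)` gives the word of the split index `(g + 2, b - g) ++ t` of the first block `b + 1`.
[folklore] -/
theorem shuffleWords_gap_lt (b g : ℕ) (hg : g < b) {t : List ℕ} (ht : ∀ i ∈ t, 1 ≤ i) :
    MZV.ofBinaryWord ((MZV.binaryWord ((b + 1) :: t)).insertIdx (g + 1) true) =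
      (g + 2) :: (b - g) :: t := by
  rw [shuffleWords_binaryWord_succ_cons,
    shuffleWords_insertIdx_replicate_append b (g + 1) (Nat.succ_le_of_lt hg) false true,
    shuffleWords_ofBinaryWord_block, shuffleWords_ofBinaryWord_block, MZV.ofBinaryWord_binaryWord ht]
  congr 2
  omega

/-- Gap right after the closing `1` of the first block: inserting `1` after the first `b + 1`
letters of `0^b 1 ε(t)` gives the word of the insertion index `(b + 1, 1) ++ t`. [folklore] -/
theorem shuffleWords_gap_eq (b : ℕ) {t : List ℕ} (ht : ∀ i ∈ t, 1 ≤ i) :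
    MZV.ofBinaryWord ((MZV.binaryWord ((b + 1) :: t)).insertIdx (b + 1) true) =
      (b + 1) :: 1 :: t := by
  have h := shuffleWords_insertIdx_length_add (List.replicate b false) (true :: MZV.binaryWord t)
    1 true
  rw [List.length_replicate] at h
  rw [shuffleWords_binaryWord_succ_cons, h, List.insertIdx_succ_cons, List.insertIdx_zero,
    shuffleWords_ofBinaryWord_block, shuffleWords_ofBinaryWord_true, MZV.ofBinaryWord_binaryWord ht]

/-- Gaps beyond the first block: inserting `1` after the first `b + 1 + (q + 1)` letters of
`0^b 1 ε(t)` is inserting it after the first `q + 1` letters of `ε(t)`, with the first entry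
`b + 1` prepended to the index. [folklore] -/
theorem shuffleWords_gap_add (b q : ℕ) (t : List ℕ) :
    MZV.ofBinaryWord ((MZV.binaryWord ((b + 1) :: t)).insertIdx (b + 1 + q + 1) true) =
      (b + 1) :: MZV.ofBinaryWord ((MZV.binaryWord t).insertIdx (q + 1) true) := by
  have h := shuffleWords_insertIdx_length_add (List.replicate b false) (true :: MZV.binaryWord t)
    (q + 1 + 1) true
  rw [List.length_replicate, show b + (q + 1 + 1) = b + 1 + q + 1 by omega] at h
  rw [shuffleWords_binaryWord_succ_cons, h, List.insertIdx_succ_cons,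
    shuffleWords_ofBinaryWord_block]

/-! ## The identity -/

/-- **Shuffle words = splits + insertions** (`Finset.range` form, any additive commutative monoid of
values).  For an index `s` with positive entries and weight `n`, summing `Z` over the indices of the
`n` words `ε(s)` with the letter `1` inserted after the first `p` letters (`p = 1, …, n`) gives the sum
of `Z` over Hoffman's split indices `(…, s_i − j, j + 1, …)` (`0 ≤ j ≤ s_i − 2`) plus the sum of `Z`
over the insertion indices `(s₁, …, s_{i+1}, 1, …)`. [cite: Hoffman1992, Thm 5.1] -/
theorem shuffleWords_finset {M : Type*} [AddCommMonoid M] :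
    ∀ (s : List ℕ), (∀ i ∈ s, 1 ≤ i) → ∀ Z : List ℕ → M,
      ∑ g ∈ Finset.range (MZV.weight s),
          Z (MZV.ofBinaryWord ((MZV.binaryWord s).insertIdx (g + 1) true)) =
        ∑ i ∈ Finset.range s.length, ∑ j ∈ Finset.range (s.getD i 0 - 1),
            Z (s.take i ++ [s.getD i 0 - j, j + 1] ++ s.drop (i + 1)) +
          ∑ i ∈ Finset.range s.length, Z (s.take (i + 1) ++ [1] ++ s.drop (i + 1))
  | [], _, Z => by simp [MZV.weight]
  | 0 :: t, h, Z => absurd (h 0 List.mem_cons_self) (by omega)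
  | (b + 1) :: t, h, Z => by
    have ht : ∀ i ∈ t, 1 ≤ i := fun i hi => h i (List.mem_cons_of_mem _ hi)
    have ih := shuffleWords_finset t ht (fun u => Z ((b + 1) :: u))
    have hw : MZV.weight ((b + 1) :: t) = (b + 1) + MZV.weight t := by simp [MZV.weight]
    -- the gap words, gap by gap
    rw [hw, Finset.sum_range_add, Finset.sum_range_succ, shuffleWords_gap_eq b ht,
      Finset.sum_congr rfl fun g hg => by rw [shuffleWords_gap_lt b g (Finset.mem_range.mp hg) ht]]
    simp only [shuffleWords_gap_add, ih]
    -- the splits and insertions of `(b + 1) :: t`, block `0` versus the later blocks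
    rw [List.length_cons, Finset.sum_range_succ', Finset.sum_range_succ']
    simp only [List.getD_cons_succ, List.getD_cons_zero, List.take_succ_cons, List.take_zero,
      List.drop_succ_cons, List.drop_zero, List.cons_append, List.nil_append, Nat.add_sub_cancel]
    -- the splits of the first block come in reverse order
    have hrefl : ∑ g ∈ Finset.range b, Z ((g + 2) :: (b - g) :: t) =
        ∑ j ∈ Finset.range b, Z ((b + 1 - j) :: (j + 1) :: t) := by
      rw [← Finset.sum_range_reflect (fun j => Z ((b + 1 - j) :: (j + 1) :: t)) b]
      refine Finset.sum_congr rfl fun g hg => ?_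
      have hg' := Finset.mem_range.mp hg
      rw [show b + 1 - (b - 1 - g) = g + 2 by omega, show b - 1 - g + 1 = b - g by omega]
    rw [hrefl]
    abel

/-- STUB (shuffle words = splits + insertions; pure list combinatorics).  For admissible `s` of weight `n`, the
`n` words obtained by inserting the letter `1` at the gaps `g = 1, …, n` of the word `0^{s₁-1}1⋯0^{s_k-1}1`
are, as a multiset of indices, exactly Hoffman's split indices `(…, s_i − j, j + 1, …)` (`0 ≤ j ≤ s_i − 2`)
together with the `k` insertions `(s₁,…,s_{i+1}, 1, s_{i+2},…)` — so the corresponding sums of any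
`Z`-values agree. [cite: Hoffman1992, Thm 5.1] -/
theorem stub_shuffleWords : ∀ (s : List ℕ), MZV.IsAdmissible s → ∀ Z : List ℕ → KZ.FormalRep, ((List.range (MZV.weight s)).map (fun g => Z (MZV.ofBinaryWord ((MZV.binaryWord s).insertIdx (g + 1) true)))).sum = ((List.range s.length).map (fun i => ((List.range (s.getD i 0 - 1)).map (fun j => Z (s.take i ++ [s.getD i 0 - j, j + 1] ++ s.drop (i + 1)))).sum)).sum + ((List.range s.length).map (fun i => Z (s.take (i + 1) ++ [1] ++ s.drop (i + 1)))).sum := by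
  intro s hs Z
  simp only [Summit.KontsevichZagierPeriods.HoffmanRelationInKZ.Negative.list_sum_range_map_finset]
  exact shuffleWords_finset s hs.1 Z

end Summit.KontsevichZagierPeriods.FurushoPentagon.HoffmanRelationInKZ
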